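import Summits.QuantumAdvantage.QuantumAdvantage.Theorems.CertDialA
import HarnessLib

/-!
# CertDial (B) — decomp-qadv lens-2 (structural dichotomy: special vs generic), generation 28, part 2/3

Part 2/3 of NODE «CertDial» (memo in part A's header and `NODE-g28.md`): §3a short representations on a finite input family (`RepOn`,
`repOn_short`), §3b the kernel vector alternates along a zero arc (`iter_alt`, `kvec_arc`), §3c THEOREM B — SPARSE REPAIR (`repair`,
`sparseRepair`, `sparse_family_not_universal`): odd-class inputs vanishing on the arc `[0, L)`, `2|𝒳|+1 ≤ L ≤ n`, any rows outside the arc ⇒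
affine rows on the arc win them all.  `lean check` (own closure) rc 0 · 0 sorry · 0 warning; axioms standard.
-/

set_option linter.dupNamespace false
set_option linter.style.longLine false

noncomputable section
open scoped Classical

namespace Summit.QuantumAdvantage.QuantumAdvantage.Theorems.CertDial
open Finset
open Literature.Computability.QuantumComplexity Literature.Computability.QuantumComplexity.RingHLF
open Summit.QuantumAdvantage.AdviceFreeQNC0
open Literature.Computability.MetaComplexity Literature.Computability.MetaComplexity.Smolensky
open Summit.QuantumAdvantage.QuantumAdvantage.Theorems.RingPeriodFold
  (kvec kernel_pair_of_oddZeros kvec_ne_zero rel_iff_of_kernel_pair)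
open Summit.QuantumAdvantage.QuantumAdvantage.Theorems.LightDial (wt lightLosing LightFail mono_singleton_apply)
open Summit.QuantumAdvantage.QuantumAdvantage.Theorems.ParityDial (PGlobalFail OGlobalFail PLocalFail IsParityLocal)
open Summit.QuantumAdvantage.QuantumAdvantage.Theses.ExactnessDial (NoPerfectTwo3)

variable {n : ℕ}

/-! ## §3 Sparse repair: an affine FAR FIELD wins every sparse sub-game against an arbitrary near field -/

/-- on the odd class, winning is the single parity test against the canonical kernel vector (in `𝔽₂`). -/
theorem rel_iff_dz (hn : 3 ≤ n) {x : Fin n → Bool} (hx : OddZeros x) (z : Fin n → Bool) :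
    Rel x z ↔ dz (kvec x) z = sgn x := by
  rw [rel_iff_of_kernel_pair x (kvec x) _ (kernel_pair_of_oddZeros hn hx), dot2_eq_signBit_iff]; rfl

/-! ### §3a Finite sums of affine answer bits restricted to a finite input family can be made SHORT -/

/-- `g` agrees on the input family `𝒳` with a sum of `k` affine answer bits. -/
def RepOn (𝒳 : Finset (Fin n → Bool)) (g : BFn n) (k : ℕ) : Prop :=
  ∃ R : Fin k → CubeFn (ZMod 3) n, (∀ i, R i ∈ lowDeg (ZMod 3) n 1) ∧ ∀ x ∈ 𝒳, g x = ∑ i, lev (R i) x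

/-- every `𝔽₂`-valued function is a finite sum of affine answer bits (the span lemma, unrolled). -/
theorem exists_rep (g : BFn n) :
    ∃ (k : ℕ) (R : Fin k → CubeFn (ZMod 3) n), (∀ i, R i ∈ lowDeg (ZMod 3) n 1) ∧ g = ∑ i, lev (R i) := by
  have hg : g ∈ levSpan n := by rw [levSpan_eq_top]; exact Submodule.mem_top
  induction hg using Submodule.span_induction with
  | mem f hf =>
    obtain ⟨R, hR, rfl⟩ := hf
    exact ⟨1, fun _ => R, fun _ => hR, by simp⟩
  | zero => exact ⟨0, Fin.elim0, fun i => i.elim0, by simp⟩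
  | add f f' _ _ ih ih' =>
    obtain ⟨k, R, hR, rfl⟩ := ih
    obtain ⟨k', R', hR', rfl⟩ := ih'
    refine ⟨k + k', Fin.append R R', fun i => ?_, ?_⟩
    · induction i using Fin.addCases with
      | left i => rw [Fin.append_left]; exact hR i
      | right i => rw [Fin.append_right]; exact hR' i
    · rw [Fin.sum_univ_add]
      simp [Fin.append_left, Fin.append_right]
  | smul a f _ ih =>
    obtain ⟨k, R, hR, rfl⟩ := ih
    have ha : a = 0 ∨ a = 1 := by revert a; decide
    rcases ha with rfl | rfl
    · exact ⟨0, Fin.elim0, fun i => i.elim0, by simp⟩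
    · exact ⟨k, R, hR, by simp⟩

/-- some representation exists (of some length). -/
theorem repOn_exists (𝒳 : Finset (Fin n → Bool)) (g : BFn n) : ∃ k, RepOn 𝒳 g k := by
  obtain ⟨k, R, hR, hg⟩ := exists_rep g
  exact ⟨k, R, hR, fun x _ => by rw [hg, Finset.sum_apply]⟩

/-- a representation longer than `|𝒳|` can be shortened: its restricted answer bits are linearly dependent over `𝔽₂`, and a
vanishing sub-sum can be deleted. -/
theorem repOn_shorten {𝒳 : Finset (Fin n → Bool)} {g : BFn n} {k : ℕ} (h : RepOn 𝒳 g k) (hk : 𝒳.card < k) :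
    ∃ k' < k, RepOn 𝒳 g k' := by
  obtain ⟨R, hR, hg⟩ := h
  -- the restricted answer bits, as vectors of the `|𝒳|`-dimensional space of functions on `𝒳`
  let w : Fin k → (↥𝒳 → ZMod 2) := fun i x => lev (R i) x.1
  have hdep : ¬ LinearIndependent (ZMod 2) w := by
    intro hw
    have h1 := hw.fintype_card_le_finrank
    rw [Module.finrank_fintype_fun_eq_card, Fintype.card_coe, Fintype.card_fin] at h1
    omega
  obtain ⟨c, hc, i₀, hi₀⟩ := Fintype.not_linearIndependent_iff.1 hdep
  -- the vanishing sub-sum, evaluated at the inputs of `𝒳`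
  have hcx : ∀ x ∈ 𝒳, ∑ i, c i * lev (R i) x = 0 := by
    intro x hx
    have := congrFun hc ⟨x, hx⟩
    simpa [w, Finset.sum_apply] using this
  -- delete the indices with `c i = 1`
  let J := {i : Fin k // c i = 0}
  have hJ : Fintype.card J < k := by
    have := Fintype.card_subtype_lt (p := fun i : Fin k => c i = 0) hi₀
    rwa [Fintype.card_fin] at this
  let e := Fintype.equivFin J
  refine ⟨Fintype.card J, hJ, fun j => R (e.symm j).1, fun j => hR _, fun x hx => ?_⟩
  have h01 : ∀ a : ZMod 2, a ≠ 0 → 1 + a = 0 := by decide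
  calc g x = ∑ i, lev (R i) x := hg x hx
    _ = ∑ i, (1 + c i) * lev (R i) x + ∑ i, c i * lev (R i) x := by
        rw [← Finset.sum_add_distrib]
        refine Finset.sum_congr rfl fun i _ => ?_
        have h2 : ∀ a b : ZMod 2, b = (1 + a) * b + a * b := by decide
        exact h2 (c i) (lev (R i) x)
    _ = ∑ i, (1 + c i) * lev (R i) x := by rw [hcx x hx, add_zero]
    _ = ∑ i ∈ univ.filter (fun i : Fin k => c i = 0), lev (R i) x := by
        rw [Finset.sum_filter]
        refine Finset.sum_congr rfl fun i _ => ?_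
        by_cases hci : c i = 0
        · simp [hci]
        · rw [if_neg hci, h01 _ hci, zero_mul]
    _ = ∑ j : J, lev (R j.1) x := Finset.sum_subtype _ (fun i => by simp) (fun i => lev (R i) x)
    _ = ∑ j : Fin (Fintype.card J), lev (R (e.symm j).1) x :=
        Fintype.sum_equiv e _ _ fun j => by simp

/-- ★ SHORT REPRESENTATION: on a family of `|𝒳|` inputs, every `𝔽₂`-valued function is a sum of AT MOST `|𝒳|` affine answer bits. -/
theorem repOn_short (𝒳 : Finset (Fin n → Bool)) (g : BFn n) : ∃ k ≤ 𝒳.card, RepOn 𝒳 g k := by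
  have hex := repOn_exists 𝒳 g
  refine ⟨Nat.find hex, ?_, Nat.find_spec hex⟩
  by_contra hlt
  push Not at hlt
  obtain ⟨k', hk', hrep⟩ := repOn_shorten (Nat.find_spec hex) hlt
  exact Nat.find_min hex hk' hrep

/-! ### §3b The kernel vector of an input vanishing on the arc `[0, L)` alternates along the arc -/

/-- the initial state of the canonical kernel trajectory. -/
def s₀ (x : Fin n → Bool) : St := fixVec (sigmaSum (List.ofFn x))

/-- the initial state of THE kernel trajectory is not `(0,0)`. -/
theorem s₀_ne_zero (x : Fin n → Bool) : s₀ x ≠ (false, false) := fixVec_ne_zero _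

/-- `kvec` is the second component of the automaton trajectory from `s₀`. -/
theorem kvec_apply (x : Fin n → Bool) (k : Fin n) : kvec x k = (iter x k.val (s₀ x)).2 := rfl

/-- on a zero the automaton swaps its two components. -/
theorem tstep_false (s : St) : tstep false s = (s.2, s.1) := by
  obtain ⟨a, b⟩ := s; cases a <;> cases b <;> rfl

/-- along an arc of zeros starting at position `0` the trajectory just swaps its two components. -/
theorem iter_alt (x : Fin n → Bool) {L : ℕ} (hL : L ≤ n) (hoff : ∀ k : Fin n, (k : ℕ) < L → x k = false) (s : St) :
    ∀ k, k ≤ L → iter x k s = if k % 2 = 0 then s else (s.2, s.1) := by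
  intro k
  induction k with
  | zero => intro _; simp
  | succ k ih =>
    intro hk
    have hkn : k < n := by omega
    rw [iter_succ x hkn, hoff ⟨k, hkn⟩ (by simpa using hk), tstep_false, ih (by omega)]
    rcases Nat.mod_two_eq_zero_or_one k with h0 | h1
    · have : (k + 1) % 2 = 1 := by omega
      simp [h0, this]
    · have : (k + 1) % 2 = 0 := by omega
      simp [h1, this]

/-- ★ on the arc the kernel vector is 2-periodic: `kvec x (2j) = (s₀ x).2`, `kvec x (2j+1) = (s₀ x).1`. -/
theorem kvec_arc (x : Fin n → Bool) {L : ℕ} (hL : L ≤ n) (hoff : ∀ k : Fin n, (k : ℕ) < L → x k = false)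
    (b : Fin n) (hb : (b : ℕ) < L) :
    kvec x b = if (b : ℕ) % 2 = 0 then (s₀ x).2 else (s₀ x).1 := by
  rw [kvec_apply, iter_alt x hL hoff (s₀ x) b.val hb.le]
  split_ifs <;> rfl

/-! ### §3c The repaired strategy and its win -/

/-- `[bit]` in `𝔽₂`. -/
def bt (b : Bool) : ZMod 2 := if b = true then 1 else 0

/-- `bt b` is idempotent. -/
theorem bt_mul_self (b : Bool) : bt b * bt b = bt b := by cases b <;> simp [bt]

/-- the contribution of the rows OUTSIDE the arc (positions `≥ L`, playing `Q`) to the parity test of input `x`. -/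
def offSum (L : ℕ) (Q : Fin n → CubeFn (ZMod 3) n) (x : Fin n → Bool) : ZMod 2 :=
  ∑ b : Fin n, if L ≤ (b : ℕ) then bt (kvec x b) * lev (Q b) x else 0

/-- the DEFICIT the arc rows must supply. -/
def deficit (L : ℕ) (Q : Fin n → CubeFn (ZMod 3) n) (x : Fin n → Bool) : ZMod 2 := sgn x + offSum L Q x

/-- row `j` of a finite list of rows, `0` beyond its end. -/
def rowAt {m : ℕ} (R : Fin m → CubeFn (ZMod 3) n) (j : ℕ) : CubeFn (ZMod 3) n := if h : j < m then R ⟨j, h⟩ else 0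

/-- `rowAt` inside the index range. -/
theorem rowAt_of_lt {m : ℕ} (R : Fin m → CubeFn (ZMod 3) n) (j : Fin m) : rowAt R (j : ℕ) = R j := by
  simp [rowAt, j.isLt]

/-- `rowAt` outside the index range is the zero row, whose level set is empty. -/
theorem lev_rowAt_of_le {m : ℕ} (R : Fin m → CubeFn (ZMod 3) n) {j : ℕ} (hj : m ≤ j) (x : Fin n → Bool) :
    lev (rowAt R j) x = 0 := by
  simp [rowAt, lev, show ¬ j < m by omega]

/-- `rowAt` of affine rows is affine. -/
theorem rowAt_mem {m : ℕ} {R : Fin m → CubeFn (ZMod 3) n} (hR : ∀ i, R i ∈ lowDeg (ZMod 3) n 1) (j : ℕ) :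
    rowAt R j ∈ lowDeg (ZMod 3) n 1 := by
  unfold rowAt; split_ifs
  · exact hR _
  · exact Submodule.zero_mem _

/-- THE REPAIRED STRATEGY: outside the arc play `Q`; on the arc, even positions `2j` play `RE j`, odd positions `2j+1` play `RO j`. -/
def repair (L : ℕ) (Q : Fin n → CubeFn (ZMod 3) n) {m m' : ℕ} (RE : Fin m → CubeFn (ZMod 3) n)
    (RO : Fin m' → CubeFn (ZMod 3) n) : Fin n → CubeFn (ZMod 3) n := fun t =>
  if (t : ℕ) < L then (if (t : ℕ) % 2 = 0 then rowAt RE ((t : ℕ) / 2) else rowAt RO ((t : ℕ) / 2)) else Q t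

/-- the parity test of ANY strategy splits into arc-even, arc-odd and off-arc parts. -/
theorem dz_ans_eq (v : Fin n → Bool) (P : Fin n → CubeFn (ZMod 3) n) (x : Fin n → Bool) :
    dz v (ans P x) = ∑ b : Fin n, bt (v b) * lev (P b) x := by
  unfold dz ans bt lev
  refine Finset.sum_congr rfl fun b _ => ?_
  by_cases hv : v b = true <;> by_cases hP : P b x = 1 <;> simp [hv, hP]

/-- a sum over the ring splits into even arc slots, odd arc slots and the off-arc positions. -/
theorem sum_split3 (L : ℕ) (f : Fin n → ZMod 2) :
    ∑ b : Fin n, f b = ∑ b : Fin n, (if (b : ℕ) < L ∧ (b : ℕ) % 2 = 0 then f b else 0) +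
      ∑ b : Fin n, (if (b : ℕ) < L ∧ (b : ℕ) % 2 = 1 then f b else 0) + ∑ b : Fin n, (if L ≤ (b : ℕ) then f b else 0) := by
  rw [← Finset.sum_add_distrib, ← Finset.sum_add_distrib]
  refine Finset.sum_congr rfl fun b _ => ?_
  by_cases h1 : (b : ℕ) < L
  · rcases Nat.mod_two_eq_zero_or_one b with h0 | h0
    · simp [h1, h0, show ¬ L ≤ (b : ℕ) by omega]
    · simp [h1, h0, show ¬ L ≤ (b : ℕ) by omega]
  · simp [h1, show L ≤ (b : ℕ) by omega]

/-- the even arc rows contribute `[q] · Σ_j [RE j x = 1]`. -/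
theorem arc_even_sum (x : Fin n → Bool) {L : ℕ} (hL : L ≤ n) (hoff : ∀ k : Fin n, (k : ℕ) < L → x k = false)
    (Q : Fin n → CubeFn (ZMod 3) n) {m m' : ℕ} (RE : Fin m → CubeFn (ZMod 3) n) (RO : Fin m' → CubeFn (ZMod 3) n)
    (hm : 2 * m ≤ L) :
    ∑ b : Fin n, (if (b : ℕ) < L ∧ (b : ℕ) % 2 = 0 then bt (kvec x b) * lev (repair L Q RE RO b) x else 0) =
      bt (s₀ x).2 * ∑ j : Fin m, lev (RE j) x := by
  -- the slots `2j`, `j < m`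
  let e : Fin m ↪ Fin n := ⟨fun j => ⟨2 * (j : ℕ), by omega⟩, fun j j' h => by
    have := congrArg Fin.val h; exact Fin.ext (by simpa using this)⟩
  have hterm : ∀ b : Fin n, (if (b : ℕ) < L ∧ (b : ℕ) % 2 = 0 then bt (kvec x b) * lev (repair L Q RE RO b) x else 0) =
      if (b : ℕ) < L ∧ (b : ℕ) % 2 = 0 then bt (s₀ x).2 * lev (rowAt RE ((b : ℕ) / 2)) x else 0 := by
    intro b
    split_ifs with h
    · rw [kvec_arc x hL hoff b h.1, if_pos h.2]
      simp [repair, h.1, h.2]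
    · rfl
  rw [Finset.sum_congr rfl fun b _ => hterm b]
  rw [← Finset.sum_subset (Finset.subset_univ (univ.map e))]
  · rw [Finset.sum_map, Finset.mul_sum]
    refine Finset.sum_congr rfl fun j _ => ?_
    have hj : (2 * (j : ℕ)) < L ∧ (2 * (j : ℕ)) % 2 = 0 := ⟨by omega, by omega⟩
    simp only [e, Function.Embedding.coeFn_mk, hj, and_self, if_true]
    rw [show 2 * (j : ℕ) / 2 = (j : ℕ) by omega, rowAt_of_lt]
  · intro b _ hb
    split_ifs with h
    · have hbm : m ≤ (b : ℕ) / 2 := by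
        by_contra hlt
        push Not at hlt
        refine hb (Finset.mem_map.2 ⟨⟨(b : ℕ) / 2, hlt⟩, Finset.mem_univ _, Fin.ext ?_⟩)
        simp only [e, Function.Embedding.coeFn_mk]
        omega
      rw [lev_rowAt_of_le RE hbm, mul_zero]
    · rfl

/-- the odd arc rows contribute `[p] · Σ_j [RO j x = 1]`. -/
theorem arc_odd_sum (x : Fin n → Bool) {L : ℕ} (hL : L ≤ n) (hoff : ∀ k : Fin n, (k : ℕ) < L → x k = false)
    (Q : Fin n → CubeFn (ZMod 3) n) {m m' : ℕ} (RE : Fin m → CubeFn (ZMod 3) n) (RO : Fin m' → CubeFn (ZMod 3) n)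
    (hm' : 2 * m' + 1 ≤ L) :
    ∑ b : Fin n, (if (b : ℕ) < L ∧ (b : ℕ) % 2 = 1 then bt (kvec x b) * lev (repair L Q RE RO b) x else 0) =
      bt (s₀ x).1 * ∑ j : Fin m', lev (RO j) x := by
  let e : Fin m' ↪ Fin n := ⟨fun j => ⟨2 * (j : ℕ) + 1, by omega⟩, fun j j' h => by
    have := congrArg Fin.val h; exact Fin.ext (by simpa using this)⟩
  have hterm : ∀ b : Fin n, (if (b : ℕ) < L ∧ (b : ℕ) % 2 = 1 then bt (kvec x b) * lev (repair L Q RE RO b) x else 0) =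
      if (b : ℕ) < L ∧ (b : ℕ) % 2 = 1 then bt (s₀ x).1 * lev (rowAt RO ((b : ℕ) / 2)) x else 0 := by
    intro b
    split_ifs with h
    · rw [kvec_arc x hL hoff b h.1, if_neg (by omega)]
      simp [repair, h.1, show ¬ (b : ℕ) % 2 = 0 by omega]
    · rfl
  rw [Finset.sum_congr rfl fun b _ => hterm b]
  rw [← Finset.sum_subset (Finset.subset_univ (univ.map e))]
  · rw [Finset.sum_map, Finset.mul_sum]
    refine Finset.sum_congr rfl fun j _ => ?_
    have hj : (2 * (j : ℕ) + 1) < L ∧ (2 * (j : ℕ) + 1) % 2 = 1 := ⟨by omega, by omega⟩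
    simp only [e, Function.Embedding.coeFn_mk, hj, and_self, if_true]
    rw [show (2 * (j : ℕ) + 1) / 2 = (j : ℕ) by omega, rowAt_of_lt]
  · intro b _ hb
    split_ifs with h
    · have hbm : m' ≤ (b : ℕ) / 2 := by
        by_contra hlt
        push Not at hlt
        refine hb (Finset.mem_map.2 ⟨⟨(b : ℕ) / 2, hlt⟩, Finset.mem_univ _, Fin.ext ?_⟩)
        simp only [e, Function.Embedding.coeFn_mk]
        omega
      rw [lev_rowAt_of_le RO hbm, mul_zero]
    · rfl

/-- the off-arc rows contribute `offSum`. -/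
theorem off_sum (x : Fin n → Bool) (L : ℕ) (Q : Fin n → CubeFn (ZMod 3) n) {m m' : ℕ}
    (RE : Fin m → CubeFn (ZMod 3) n) (RO : Fin m' → CubeFn (ZMod 3) n) :
    ∑ b : Fin n, (if L ≤ (b : ℕ) then bt (kvec x b) * lev (repair L Q RE RO b) x else 0) = offSum L Q x := by
  unfold offSum
  refine Finset.sum_congr rfl fun b _ => ?_
  split_ifs with h
  · simp [repair, show ¬ (b : ℕ) < L by omega]
  · rfl

/-- ★★ THEOREM B (SPARSE REPAIR).  Let `𝒳` be any family of odd-class inputs that all VANISH on the arc `[0, L)` of length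
`L ≥ 2|𝒳| + 1`, and let `Q` be ANY assignment of rows (the «near field»; no degree or locality hypothesis).  Then there are
`𝔽₃`-AFFINE rows on the arc which, together with `Q` off the arc, WIN EVERY INPUT OF `𝒳`.
Consequently no argument that constrains a strategy only through (i) its rows near the supports of a sparse input family and
(ii) the DEGREE of the remaining rows can prove a light-input law for generic strategies: bounded «universal» input families,
sparse sub-systems, and Ramsey/canonisation of the near field over a sparse position set are all repaired by an affine far field
(by rotation the arc may sit anywhere; a support set `U` of `u` positions misses an arc of length `≥ n/u − 1`, so for the light
inputs of weight `≤ w` inside `U` the hypothesis holds as soon as `n ≥ u·(2(u+1)^w + 2)`). -/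
theorem sparseRepair (hn : 3 ≤ n) {L : ℕ} (hL : L ≤ n) (𝒳 : Finset (Fin n → Bool))
    (hodd : ∀ x ∈ 𝒳, OddZeros x) (hoff : ∀ x ∈ 𝒳, ∀ k : Fin n, (k : ℕ) < L → x k = false)
    (hcard : 2 * 𝒳.card + 1 ≤ L) (Q : Fin n → CubeFn (ZMod 3) n) :
    ∃ P : Fin n → CubeFn (ZMod 3) n,
      (∀ t : Fin n, L ≤ (t : ℕ) → P t = Q t) ∧ (∀ t : Fin n, (t : ℕ) < L → P t ∈ lowDeg (ZMod 3) n 1) ∧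
      ∀ x ∈ 𝒳, Rel x (ans P x) := by
  -- short affine representations of the two target functions on `𝒳`
  obtain ⟨m, hm, RE, hRE, hZE⟩ := repOn_short 𝒳 (fun x => bt (s₀ x).2 * deficit L Q x)
  obtain ⟨m', hm', RO, hRO, hZO⟩ := repOn_short 𝒳 (fun x => (1 + bt (s₀ x).2) * deficit L Q x)
  refine ⟨repair L Q RE RO, fun t ht => by simp [repair, show ¬ (t : ℕ) < L by omega], fun t ht => ?_, fun x hx => ?_⟩
  · simp only [repair, ht, if_true]
    split_ifs
    · exact rowAt_mem hRE _
    · exact rowAt_mem hRO _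
  · rw [rel_iff_dz hn (hodd x hx), dz_ans_eq, sum_split3 L,
      arc_even_sum x hL (hoff x hx) Q RE RO (by omega), arc_odd_sum x hL (hoff x hx) Q RE RO (by omega),
      off_sum x L Q RE RO, ← hZE x hx, ← hZO x hx]
    -- `([q]·[q] + [p]·(1+[q]))·(sgn + off) + off = sgn`, because `(p, q) ≠ (0, 0)`
    have key : ∀ (p q : Bool) (a o : ZMod 2), (p, q) ≠ (false, false) →
        bt q * (bt q * (a + o)) + bt p * ((1 + bt q) * (a + o)) + o = a := by decide
    have hpq : ((s₀ x).1, (s₀ x).2) ≠ (false, false) := by rw [Prod.mk.eta]; exact s₀_ne_zero x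
    beta_reduce
    unfold deficit
    exact key _ _ _ _ hpq

/-- COROLLARY (no bounded universal family, no sparse certificate): every family of odd-class inputs vanishing on a common arc of
length `≥ 2|𝒳| + 1` is won SIMULTANEOUSLY by one AFFINE strategy (degree `≤ 1 ≤ D`), which moreover may be prescribed arbitrarily
off the arc. -/
theorem sparse_family_not_universal (hn : 3 ≤ n) {D : ℕ} (hD : 1 ≤ D) {L : ℕ} (hL : L ≤ n) (𝒳 : Finset (Fin n → Bool))
    (hodd : ∀ x ∈ 𝒳, OddZeros x) (hoff : ∀ x ∈ 𝒳, ∀ k : Fin n, (k : ℕ) < L → x k = false)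
    (hcard : 2 * 𝒳.card + 1 ≤ L) :
    ∃ P : Fin n → CubeFn (ZMod 3) n, (∀ i, P i ∈ lowDeg (ZMod 3) n D) ∧ ∀ x ∈ 𝒳, Rel x (ans P x) := by
  obtain ⟨P, hoffP, harc, hwin⟩ := sparseRepair hn hL 𝒳 hodd hoff hcard (fun _ => 0)
  refine ⟨P, fun i => ?_, hwin⟩
  by_cases hi : (i : ℕ) < L
  · exact lowDeg_mono hD (harc i hi)
  · rw [hoffP i (by omega)]; exact Submodule.zero_mem _

end Summit.QuantumAdvantage.QuantumAdvantage.Theorems.CertDial
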